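import Mathlib
import Summits.ValiantsHypothesis.ValiantsHypothesis.Theorems.NewtonUnitEquationsDissociatedUniformTotalsLawMinkowskiExact
import HarnessLib

/-!
# Crux `NewtonUnitEquations.DissociatedUniform` (stmt-ValiantsHypothesis-5905): the EXACT vertex count of a planar Minkowski sum —
# `V(X + Y) = V(X) + V(Y)` when no chord of `X` is parallel to a chord of `Y`

Follow-up of `…TotalsLawMinkowskiExact` (faces / edge normals / ends).  Proved here:
* `perp_add`, `perp_neg`, `perp_perp`, `ne_zero_of_isStrictTop`;
* **`exists_isEnd_stage`** (one quarter-turn of the rotation: if `p` is the strict `w`-top and some point lies strictly on the `−perp w`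
  side, the first tie while rotating `w` towards `−perp w` is an edge normal with `perp`-end `p`) and **`exists_isEdgeNormal_isEnd`**
  (every hull vertex of a finite planar set with two distinct points is the `perp`-end of an edge — at most two stages);
* `SameDir.symm`, `not_sameDir_of_cross_ne` (under the no-parallel-chords hypothesis an edge normal of `X` and one of `Y` are never
  positive multiples: both chords would be orthogonal to it);
* **`add_le_ncard_extremePoints_add`**: `X`, `Y` finite planar sets with two distinct points each and `cross (a − b) (u − v) ≠ 0` for
  all chords ⟹ `V(X) + V(Y) ≤ V(X + Y)` (one edge normal per vertex of `X` and of `Y`, all edge normals of `X + Y` with pairwise distinct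
  ends), and with the tree's `ncard_extremePoints_add_le` **`ncard_extremePoints_add_eq`**: `V(X + Y) = V(X) + V(Y)`.
Used by `…TotalsLawFibreSumProduct` (product configurations: `FibreSumDominance C` fails for every `C`).  Folklore (the normal fan of a
Minkowski sum is the common refinement).  Nothing here bears on VP ≠ VNP.
[folklore]
-/

set_option linter.dupNamespace false -- `ValiantsHypothesis.ValiantsHypothesis` (summit = problem) in every name

open scoped BigOperators Pointwise

namespace Summit.ValiantsHypothesis.ValiantsHypothesis.Theorems.NewtonUnitEquationsDissociatedUniform

namespace TotalsLaw

namespace MinkowskiExact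

open Literature.Computability.AlgebraicComplexity.KPTT.PlanarMinkowski

/-! ### Every hull vertex is the end of an edge -/

/-- `perp` is additive. [folklore] -/
theorem perp_add (a b : Fin 2 → ℝ) : perp (a + b) = perp a + perp b := by
  ext i
  fin_cases i
  · simp only [Fin.zero_eta, Fin.isValue, perp_zero, Pi.add_apply, neg_add]
  · simp only [Fin.mk_one, Fin.isValue, perp_one, Pi.add_apply]

/-- `perp` commutes with negation. [folklore] -/
theorem perp_neg (a : Fin 2 → ℝ) : perp (-a) = -perp a := by
  ext i; fin_cases i <;> simp [perp]

/-- `perp ∘ perp = −id`. [folklore] -/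
theorem perp_perp (a : Fin 2 → ℝ) : perp (perp a) = -a := by
  ext i; fin_cases i <;> simp [perp]

/-- A strictly exposing weight of a point with a companion is non-zero. [folklore] -/
theorem ne_zero_of_isStrictTop {F : Finset (Fin 2 → ℝ)} {w p : Fin 2 → ℝ} (hw : IsStrictTop w F p)
    (hF : ∃ q ∈ F, q ≠ p) : w ≠ 0 := by
  obtain ⟨q, hq, hqp⟩ := hF
  intro h0
  have := hw.2 q hq hqp
  rw [h0, zero_dotProduct, zero_dotProduct] at this
  exact lt_irrefl _ this

/-- **One stage of the rotation.**  If `p` is the strict `w`-top and some point lies strictly on the `−perp w` side of `p`, then rotating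
`w` towards `−perp w` until the first tie produces an edge normal whose `perp`-end is `p`. [folklore] -/
theorem exists_isEnd_stage {F : Finset (Fin 2 → ℝ)} {w p : Fin 2 → ℝ} (hw : IsStrictTop w F p)
    (hex : ∃ q ∈ F, 0 < (-perp w) ⬝ᵥ (q - p)) : ∃ n, IsEdgeNormal F n ∧ IsEnd F n p := by
  classical
  set u := -perp w with hu
  set Q := F.filter (fun q => 0 < u ⬝ᵥ (q - p)) with hQ
  have hQne : Q.Nonempty := by
    obtain ⟨q, hq, h⟩ := hex
    exact ⟨q, Finset.mem_filter.2 ⟨hq, h⟩⟩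
  obtain ⟨q₀, hq₀, hmin⟩ := Q.exists_min_image (fun q => -(w ⬝ᵥ (q - p)) / (u ⬝ᵥ (q - p))) hQne
  set t := -(w ⬝ᵥ (q₀ - p)) / (u ⬝ᵥ (q₀ - p)) with ht
  have hq₀F : q₀ ∈ F := (Finset.mem_filter.1 hq₀).1
  have hu₀ : 0 < u ⬝ᵥ (q₀ - p) := (Finset.mem_filter.1 hq₀).2
  have hq₀p : q₀ ≠ p := by
    intro h; rw [h, sub_self, dotProduct_zero] at hu₀; exact lt_irrefl _ hu₀
  have hw₀ : w ⬝ᵥ (q₀ - p) < 0 := by rw [dotProduct_sub]; linarith [hw.2 q₀ hq₀F hq₀p]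
  have htpos : 0 < t := div_pos (by linarith) hu₀
  have hwne : w ≠ 0 := ne_zero_of_isStrictTop hw ⟨q₀, hq₀F, hq₀p⟩
  set n := w + t • u with hn
  -- `n ⬝ (y - p) ≤ 0` on `F`, with equality at `q₀`
  have hle : ∀ y ∈ F, n ⬝ᵥ (y - p) ≤ 0 := by
    intro y hy
    rw [hn, add_dotProduct, smul_dotProduct, smul_eq_mul]
    by_cases hyp : y = p
    · rw [hyp, sub_self, dotProduct_zero, dotProduct_zero, mul_zero, add_zero]
    have hwy : w ⬝ᵥ (y - p) < 0 := by rw [dotProduct_sub]; linarith [hw.2 y hy hyp]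
    by_cases huy : 0 < u ⬝ᵥ (y - p)
    · have hty : t ≤ -(w ⬝ᵥ (y - p)) / (u ⬝ᵥ (y - p)) := hmin y (Finset.mem_filter.2 ⟨hy, huy⟩)
      have := (le_div_iff₀ huy).1 hty
      linarith
    · rw [not_lt] at huy
      have : t * (u ⬝ᵥ (y - p)) ≤ 0 := mul_nonpos_iff.2 (Or.inl ⟨htpos.le, huy⟩)
      linarith
  have heq₀ : n ⬝ᵥ (q₀ - p) = 0 := by
    rw [hn, add_dotProduct, smul_dotProduct, smul_eq_mul, ht, div_mul_cancel₀ _ hu₀.ne']; ring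
  have hpface : p ∈ face F n :=
    mem_face.2 ⟨hw.1, fun z hz => by have := hle z hz; rw [dotProduct_sub] at this; linarith⟩
  have hq₀face : q₀ ∈ face F n :=
    mem_face.2 ⟨hq₀F, fun z hz => by
      have h1 := hle z hz
      rw [dotProduct_sub] at h1 heq₀
      linarith⟩
  have hn0 : n ≠ 0 := by
    intro h0
    have h1 : n ⬝ᵥ w = w ⬝ᵥ w + t * (u ⬝ᵥ w) := by rw [hn, add_dotProduct, smul_dotProduct, smul_eq_mul]
    have h2 : u ⬝ᵥ w = 0 := by rw [hu, neg_dotProduct, dot_two, perp_zero, perp_one]; ring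
    have h3 : w ⬝ᵥ w = w 0 ^ 2 + w 1 ^ 2 := by rw [dot_two]; ring
    rw [h0, zero_dotProduct, h2, mul_zero, add_zero, h3] at h1
    linarith [normSq_pos hwne]
  refine ⟨n, ⟨hn0, p, hpface, q₀, hq₀face, hq₀p.symm⟩, hpface, fun y hy hyp => ?_⟩
  -- the perpendicular pairing: `perp n = perp w + t w = -u + t w`
  have hyF : y ∈ F := (mem_face.1 hy).1
  have hny : n ⬝ᵥ (y - p) = 0 := by rw [dotProduct_sub, dot_eq_of_mem_face hy hpface, sub_self]
  have hwy : w ⬝ᵥ (y - p) < 0 := by rw [dotProduct_sub]; linarith [hw.2 y hyF hyp]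
  have hperp : perp n = -u + t • w := by
    rw [hn, perp_add, perp_smul, hu, perp_neg, perp_perp, neg_neg, neg_neg]
  have huy : 0 ≤ u ⬝ᵥ (y - p) := by
    by_contra hlt
    rw [not_le] at hlt
    have : n ⬝ᵥ (y - p) < 0 := by
      rw [hn, add_dotProduct, smul_dotProduct, smul_eq_mul]
      nlinarith
    linarith
  have key : perp n ⬝ᵥ (y - p) < 0 := by
    rw [hperp, add_dotProduct, neg_dotProduct, smul_dotProduct, smul_eq_mul]
    nlinarith
  rw [dotProduct_sub] at key
  linarith

/-- **Every hull vertex is the end of an edge** (rotate a strictly exposing weight clockwise until a second point ties; at most two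
stages of a quarter turn each). [folklore] -/
theorem exists_isEdgeNormal_isEnd {F : Finset (Fin 2 → ℝ)} {p : Fin 2 → ℝ}
    (hp : p ∈ (convexHull ℝ (F : Set (Fin 2 → ℝ))).extremePoints ℝ) (hF : ∃ q ∈ F, q ≠ p) :
    ∃ n, IsEdgeNormal F n ∧ IsEnd F n p := by
  obtain ⟨w, hw⟩ := exists_isStrictTop_of_mem_extremePoints hp
  have hwne : w ≠ 0 := ne_zero_of_isStrictTop hw hF
  by_cases h1 : ∃ q ∈ F, 0 < (-perp w) ⬝ᵥ (q - p)
  · exact exists_isEnd_stage hw h1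
  have h1' : ∀ q ∈ F, (-perp w) ⬝ᵥ (q - p) ≤ 0 := fun q hq => not_lt.1 fun h => h1 ⟨q, hq, h⟩
  by_cases h2 : ∃ q ∈ F, q ≠ p ∧ (-perp w) ⬝ᵥ (q - p) = 0
  · -- the weight `-perp w` itself is the edge normal
    obtain ⟨q, hq, hqp, hq0⟩ := h2
    have hpn0 : -perp w ≠ 0 := by
      intro h0
      apply hwne
      have h0' : perp w = 0 := neg_eq_zero.1 h0
      have e0 := congrFun h0' 0
      have e1 := congrFun h0' 1
      simp only [perp_zero, perp_one, Pi.zero_apply, neg_eq_zero] at e0 e1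
      ext i; fin_cases i
      · exact e1
      · exact e0
    have hpface : p ∈ face F (-perp w) :=
      mem_face.2 ⟨hw.1, fun z hz => by have := h1' z hz; rw [dotProduct_sub] at this; linarith⟩
    have hqface : q ∈ face F (-perp w) :=
      mem_face.2 ⟨hq, fun z hz => by
        have := h1' z hz
        rw [dotProduct_sub] at this hq0
        linarith⟩
    refine ⟨-perp w, ⟨hpn0, p, hpface, q, hqface, hqp.symm⟩, hpface, fun y hy hyp => ?_⟩
    rw [perp_neg, perp_perp, neg_neg]
    exact hw.2 y (mem_face.1 hy).1 hyp
  · -- every other point is strictly on the `perp w` side: `-perp w` exposes `p` strictly; second stage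
    have h2' : ∀ q ∈ F, q ≠ p → (-perp w) ⬝ᵥ (q - p) < 0 := fun q hq hqp =>
      lt_of_le_of_ne (h1' q hq) fun h => h2 ⟨q, hq, hqp, h⟩
    have hw' : IsStrictTop (-perp w) F p :=
      ⟨hw.1, fun y hy hne => by have := h2' y hy hne; rw [dotProduct_sub] at this; linarith⟩
    apply exists_isEnd_stage hw'
    obtain ⟨q, hq, hqp⟩ := hF
    refine ⟨q, hq, ?_⟩
    rw [perp_neg, perp_perp, neg_neg, neg_dotProduct, dotProduct_sub]
    linarith [hw.2 q hq hqp]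

/-! ### The exact count -/

/-- Positive multiples, reversed. [folklore] -/
theorem SameDir.symm {n n' : Fin 2 → ℝ} (h : SameDir n n') : SameDir n' n := by
  obtain ⟨c, hc, rfl⟩ := h
  exact ⟨c⁻¹, inv_pos.2 hc, by rw [smul_smul, inv_mul_cancel₀ hc.ne', one_smul]⟩

/-- Under the no-parallel-chords hypothesis an edge normal of `X` and an edge normal of `Y` are never positive multiples. [folklore] -/
theorem not_sameDir_of_cross_ne {X Y : Finset (Fin 2 → ℝ)} {n m : Fin 2 → ℝ} (hn : IsEdgeNormal X n) (hm : IsEdgeNormal Y m)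
    (hGP : ∀ a ∈ X, ∀ b ∈ X, ∀ u ∈ Y, ∀ v ∈ Y, a ≠ b → u ≠ v → cross (a - b) (u - v) ≠ 0) : ¬ SameDir n m := by
  rintro ⟨c, hc, rfl⟩
  obtain ⟨hn0, a, ha, b, hb, hab⟩ := hn
  obtain ⟨-, u, hu, v, hv, huv⟩ := hm
  have h1 : n ⬝ᵥ (a - b) = 0 := by rw [dotProduct_sub, dot_eq_of_mem_face ha hb, sub_self]
  have h2 : n ⬝ᵥ (u - v) = 0 := by
    have := dot_eq_of_mem_face hu hv
    rw [smul_dotProduct, smul_dotProduct, smul_eq_mul, smul_eq_mul] at this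
    have h3 : n ⬝ᵥ u = n ⬝ᵥ v := mul_left_cancel₀ hc.ne' this
    rw [dotProduct_sub, h3, sub_self]
  exact hGP a (mem_face.1 ha).1 b (mem_face.1 hb).1 u (mem_face.1 hu).1 v (mem_face.1 hv).1 hab huv
    (cross_eq_zero_of_dot_eq_zero hn0 h1 h2)

/-- **The exact Minkowski count, lower half.**  If the finite planar sets `X`, `Y` each have two distinct points and no chord of
`X` is parallel to a chord of `Y`, then `V(X) + V(Y) ≤ V(X + Y)` (so `=`, by the tree's upper bound). [folklore] -/
theorem add_le_ncard_extremePoints_add (X Y : Finset (Fin 2 → ℝ)) (hX : ∃ a ∈ X, ∃ b ∈ X, a ≠ b)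
    (hY : ∃ u ∈ Y, ∃ v ∈ Y, u ≠ v)
    (hGP : ∀ a ∈ X, ∀ b ∈ X, ∀ u ∈ Y, ∀ v ∈ Y, a ≠ b → u ≠ v → cross (a - b) (u - v) ≠ 0) :
    ((convexHull ℝ (X : Set (Fin 2 → ℝ))).extremePoints ℝ).ncard +
        ((convexHull ℝ (Y : Set (Fin 2 → ℝ))).extremePoints ℝ).ncard ≤
      ((convexHull ℝ ((X + Y : Finset (Fin 2 → ℝ)) : Set (Fin 2 → ℝ))).extremePoints ℝ).ncard := by
  classical
  have hfinX : ((convexHull ℝ (X : Set (Fin 2 → ℝ))).extremePoints ℝ).Finite :=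
    X.finite_toSet.subset extremePoints_convexHull_subset
  have hfinY : ((convexHull ℝ (Y : Set (Fin 2 → ℝ))).extremePoints ℝ).Finite :=
    Y.finite_toSet.subset extremePoints_convexHull_subset
  set EX := hfinX.toFinset with hEX
  set EY := hfinY.toFinset with hEY
  have hXne : X.Nonempty := by obtain ⟨a, ha, -⟩ := hX; exact ⟨a, ha⟩
  have hYne : Y.Nonempty := by obtain ⟨u, hu, -⟩ := hY; exact ⟨u, hu⟩
  have compX : ∀ p : Fin 2 → ℝ, ∃ q ∈ X, q ≠ p := by
    intro p; obtain ⟨a, ha, b, hb, hab⟩ := hX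
    by_cases h : a = p
    · exact ⟨b, hb, fun h' => hab (h.trans h'.symm)⟩
    · exact ⟨a, ha, h⟩
  have compY : ∀ p : Fin 2 → ℝ, ∃ q ∈ Y, q ≠ p := by
    intro p; obtain ⟨a, ha, b, hb, hab⟩ := hY
    by_cases h : a = p
    · exact ⟨b, hb, fun h' => hab (h.trans h'.symm)⟩
    · exact ⟨a, ha, h⟩
  have hcX : ∀ p ∈ EX, ∃ n, IsEdgeNormal X n ∧ IsEnd X n p := fun p hp =>
    exists_isEdgeNormal_isEnd (hfinX.mem_toFinset.1 hp) (compX p)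
  have hcY : ∀ u ∈ EY, ∃ n, IsEdgeNormal Y n ∧ IsEnd Y n u := fun u hu =>
    exists_isEdgeNormal_isEnd (hfinY.mem_toFinset.1 hu) (compY u)
  choose! nX hnX using hcX
  choose! nY hnY using hcY
  have heY : ∀ p ∈ EX, ∃ u, IsEnd Y (nX p) u := fun p hp => exists_isEnd hYne (hnX p hp).1.1
  have heX : ∀ u ∈ EY, ∃ p, IsEnd X (nY u) p := fun u hu => exists_isEnd hXne (hnY u hu).1.1
  choose! eY heY' using heY
  choose! eX heX' using heX
  -- the family indexed by `EX ⊕ EY`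
  set I : Finset ((Fin 2 → ℝ) ⊕ (Fin 2 → ℝ)) := EX.disjSum EY with hI
  set f : (Fin 2 → ℝ) ⊕ (Fin 2 → ℝ) → (Fin 2 → ℝ) := Sum.elim nX nY with hf
  set e : (Fin 2 → ℝ) ⊕ (Fin 2 → ℝ) → (Fin 2 → ℝ) := Sum.elim (fun p => p + eY p) (fun u => eX u + u) with he
  have hfI : ∀ i ∈ I, IsEdgeNormal (X + Y) (f i) := by
    intro i hi
    rcases Finset.mem_disjSum.1 hi with ⟨p, hp, rfl⟩ | ⟨u, hu, rfl⟩
    · exact (hnX p hp).1.add_right hYne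
    · exact (hnY u hu).1.add_left hXne
  have heI : ∀ i ∈ I, IsEnd (X + Y) (f i) (e i) := by
    intro i hi
    rcases Finset.mem_disjSum.1 hi with ⟨p, hp, rfl⟩ | ⟨u, hu, rfl⟩
    · exact (hnX p hp).2.add (heY' p hp)
    · exact (heX' u hu).add (hnY u hu).2
  have hpair : ∀ i ∈ I, ∀ j ∈ I, i ≠ j → ¬ SameDir (f i) (f j) := by
    intro i hi j hj hij hs
    rcases Finset.mem_disjSum.1 hi with ⟨p, hp, rfl⟩ | ⟨u, hu, rfl⟩ <;>
      rcases Finset.mem_disjSum.1 hj with ⟨p', hp', rfl⟩ | ⟨u', hu', rfl⟩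
    · -- two vertices of `X` with proportional normals coincide
      have h1 : IsEnd X (nX p') p := (hnX p hp).2.of_sameDir hs
      exact hij (congrArg Sum.inl (h1.unique (hnX p' hp').2))
    · exact not_sameDir_of_cross_ne (hnX p hp).1 (hnY u' hu').1 hGP hs
    · exact not_sameDir_of_cross_ne (hnX p' hp').1 (hnY u hu).1 hGP hs.symm
    · have h1 : IsEnd Y (nY u') u := (hnY u hu).2.of_sameDir hs
      exact hij (congrArg Sum.inr (h1.unique (hnY u' hu').2))
  have hmain := card_le_ncard_extremePoints (X + Y) I f e hfI heI hpair
  rw [hI, Finset.card_disjSum, hEX, hEY, ← Set.ncard_eq_toFinset_card _ hfinX, ← Set.ncard_eq_toFinset_card _ hfinY] at hmain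
  exact hmain

/-- **The exact Minkowski count.**  Under the same hypotheses `V(X + Y) = V(X) + V(Y)`. [folklore] -/
theorem ncard_extremePoints_add_eq (X Y : Finset (Fin 2 → ℝ)) (hX : ∃ a ∈ X, ∃ b ∈ X, a ≠ b)
    (hY : ∃ u ∈ Y, ∃ v ∈ Y, u ≠ v)
    (hGP : ∀ a ∈ X, ∀ b ∈ X, ∀ u ∈ Y, ∀ v ∈ Y, a ≠ b → u ≠ v → cross (a - b) (u - v) ≠ 0) :
    ((convexHull ℝ ((X + Y : Finset (Fin 2 → ℝ)) : Set (Fin 2 → ℝ))).extremePoints ℝ).ncard =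
      ((convexHull ℝ (X : Set (Fin 2 → ℝ))).extremePoints ℝ).ncard +
        ((convexHull ℝ (Y : Set (Fin 2 → ℝ))).extremePoints ℝ).ncard := by
  have hXne : X.Nonempty := by obtain ⟨a, ha, -⟩ := hX; exact ⟨a, ha⟩
  have hYne : Y.Nonempty := by obtain ⟨u, hu, -⟩ := hY; exact ⟨u, hu⟩
  exact le_antisymm (ncard_extremePoints_add_le hXne hYne) (add_le_ncard_extremePoints_add X Y hX hY hGP)

end MinkowskiExact

end TotalsLaw

end Summit.ValiantsHypothesis.ValiantsHypothesis.Theorems.NewtonUnitEquationsDissociatedUniform
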